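import Literature.NumberTheory.GaloisRepresentations.LubinTateComparison
import HarnessLib

/-!
# Lubin–Tate's comparison series respects the group laws: `ϑ(F_f(X, Y)) = F_{f'}(ϑ(X), ϑ(Y))`

Topic `NumberTheory/GaloisRepresentations`; namespace
`Literature.NumberTheory.GaloisRepresentations.LubinTate` (continuation of `LubinTateComparison.lean`,
whose header lists this as "Not here: the formal-group property `ϑ(F_f(X,Y)) = F_{f'}(ϑX, ϑY)`
(Lubin–Tate (17); same argument in two variables)").

Setting of `LubinTateComparison.lean`: `𝒪` a Lubin–Tate base for `π₀` (`IsLTRing π₀ q`) and for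
`π' = u π₀`, `f ∈ 𝔉_{π₀}`, `f' ∈ 𝔉_{uπ₀}`, `ι : 𝒪 → A` into a `(π₀)`-adically complete twist base
`(A, φ)` fixing `ι(𝒪)`, `ε ∈ A` with `φ(ε) = uε`, and `ϑ = compSeries …` the comparison series
(`ϑ ≡ εX`, `f' ∘ ϑ = ϑ^φ ∘ f`). This file proves Lubin–Tate 1965, (17) p. 386 / Cassels–Fröhlich VI
§3.7 Lemma 1 (b) / de Shalit I §1.5: **`ϑ ∘ F_f = F_{f'} ∘ (ϑ × ϑ)`** as an identity in
`A⟦X₀, X₁⟧` (`subst_ltF_compSeries`). Both sides have linear part `ε(X₀ + X₁)` and satisfy the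
two-variable twisted relation `f' ∘ Φ = Φ^φ ∘ (f, f)`; by the twisted uniqueness
(`eq_of_twistDefect_eq_zero`, file `LubinTateFrobeniusTwist.lean`) they are equal. The two
verifications are the general lemmas

* `twist_subst_of_comm` — if `ψ` satisfies the twisted relation and `F ∈ 𝒪⟦X_σ⟧` commutes with `f`
  (`f ∘ F = F ∘ (f, …, f)`), then `ψ ∘ F` satisfies the twisted relation;
* `twist_comm_subst` — if `F' ∈ 𝒪⟦X_σ⟧` commutes with `f'` and every `b_j` satisfies the twisted
  relation, then `F' ∘ b` satisfies it.

This is the algebraic input for transporting Coleman's trace condition `𝒮_{f'} h = 0` along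
`θ : Ĝ_m ≃ F_{f'}` to the `Ĝ_m`-side (`θ(ζ − 1)` runs over the `f'`-torsion; de Shalit I.3.2 (5),
I.3.3 (7)), where the measure criterion of `PAdicOneVariableTraceCriterion.lean` applies.
No named facts, no definitions, no `sorry`.

## References

* [LubinTate1965] J. Lubin, J. Tate, *Formal complex multiplication in local fields*, Ann. of Math. 81
  (1965), Lemma p. 385–386, (17).
* [CasselsFrohlichANT1967] J.-P. Serre, *Local class field theory* (Cassels–Fröhlich Ch. VI), §3.7
  Lemma 1 (b).
* [deShalit1987] E. de Shalit, *Iwasawa theory of elliptic curves with complex multiplication* (1987),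
  I §1.5, I.3.2 (3)–(5) (p. 17).
-/

noncomputable section

open MvPowerSeries

namespace Literature.NumberTheory.GaloisRepresentations

namespace LubinTate

variable {A : Type*} [CommRing A]

section GroupLaw

variable {𝒪 : Type*} [CommRing 𝒪] (ι : 𝒪 →+* A) (φ : A →+* A) {π₀ : 𝒪} {q : ℕ}
variable {u₀ : 𝒪ˣ} {f f' : PowerSeries 𝒪}
  [IsAdicComplete (Ideal.span {ι π₀}) A] (hA : IsTwistBase (ι π₀) q φ)
  (hφι : ∀ a : 𝒪, φ (ι a) = ι a)
  (hf : IsLTSeries π₀ q f) (hf' : IsLTSeries ((u₀ : 𝒪) * π₀) q f')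

/-! ### Bookkeeping: series from `𝒪` and their compositions -/

omit [IsAdicComplete (Ideal.span {ι π₀}) A] in
include hφι in
/-- Multivariable series with coefficients from `𝒪` are fixed by `φ` (the step "`F^φ = F` since `F` is
defined over `𝒪`" of Lubin–Tate's Lemma). [cite: LubinTate1965, Lemma p. 385] -/
theorem mv_map_map_eq_map {σ : Type*} (F : MvPowerSeries σ 𝒪) :
    MvPowerSeries.map φ (MvPowerSeries.map ι F) = MvPowerSeries.map ι F := by
  ext n
  rw [MvPowerSeries.coeff_map, MvPowerSeries.coeff_map, hφι]

omit [IsAdicComplete (Ideal.span {ι π₀}) A] in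
/-- `f ∘ F = F ∘ (f, …, f)` over `𝒪` stays true over `A` (change of coefficients in Lubin–Tate's
(4)/(6)). [cite: LubinTate1965, Lemma p. 385] [cite: CasselsFrohlichANT1967, Ch. VI §3.7 Lemma 1] -/
theorem compLeft_map_eq_compRight_map {σ : Type*} [Fintype σ] {g : PowerSeries 𝒪}
    (hg0 : PowerSeries.constantCoeff g = 0) {F : MvPowerSeries σ 𝒪} (hF0 : F.constantCoeff = 0)
    (hF : compLeft g F = compRight g F) :
    compLeft (g.map ι) (MvPowerSeries.map ι F) = compRight (g.map ι) (MvPowerSeries.map ι F) := by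
  have hFs : PowerSeries.HasSubst F := hasSubst_of_constantCoeff hF0
  have hgX : MvPowerSeries.HasSubst
      (fun i : σ => PowerSeries.subst (MvPowerSeries.X i : MvPowerSeries σ 𝒪) g) :=
    hasSubst_compRight hg0
  have h := congrArg (MvPowerSeries.map ι) hF
  rw [compLeft, compRight, PowerSeries.map_subst hFs, MvPowerSeries.map_subst hgX] at h
  rw [compLeft, compRight, h]
  congr 1
  funext i
  rw [PowerSeries.map_subst (PowerSeries.HasSubst.of_constantCoeff_zero (MvPowerSeries.constantCoeff_X i)),
    MvPowerSeries.map_X]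

/-! ### The two twisted verifications -/

omit [IsAdicComplete (Ideal.span {ι π₀}) A] in
include hφι hf in
/-- **`ψ ∘ F` satisfies the twisted relation** if `ψ ∈ A⟦X⟧` does (`f' ∘ ψ = ψ^φ ∘ f`) and
`F ∈ 𝒪⟦X_σ⟧` (no constant term) commutes with `f` (`f ∘ F = F ∘ (f, …, f)`):
`f' ∘ (ψ ∘ F) = (ψ ∘ F)^φ ∘ (f, …, f)`. [cite: LubinTate1965, Lemma p. 385, (17)] -/
theorem twist_subst_of_comm {σ : Type*} [Fintype σ] {ψ : PowerSeries A}
    (hψ0 : PowerSeries.constantCoeff ψ = 0)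
    (hψ : PowerSeries.subst ψ (f'.map ι) = PowerSeries.subst (f.map ι) (ψ.map φ))
    {F : MvPowerSeries σ 𝒪} (hF0 : F.constantCoeff = 0) (hF : compLeft f F = compRight f F) :
    compLeft (f'.map ι) (PowerSeries.subst (MvPowerSeries.map ι F) ψ) =
      compRight (f.map ι) (MvPowerSeries.map φ (PowerSeries.subst (MvPowerSeries.map ι F) ψ)) := by
  set G : MvPowerSeries σ A := MvPowerSeries.map ι F with hG
  have hG0 : G.constantCoeff = 0 := by rw [hG, MvPowerSeries.constantCoeff_map, hF0, map_zero]
  have hGs : PowerSeries.HasSubst G := hasSubst_of_constantCoeff hG0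
  have hψs : PowerSeries.HasSubst ψ := PowerSeries.HasSubst.of_constantCoeff_zero' hψ0
  have hfs : PowerSeries.HasSubst (f.map ι) :=
    PowerSeries.HasSubst.of_constantCoeff_zero' (hf.map' ι).constantCoeff_eq_zero
  have hd : MvPowerSeries.HasSubst
      (fun i : σ => PowerSeries.subst (MvPowerSeries.X i : MvPowerSeries σ A) (f.map ι)) :=
    hasSubst_compRight (hf.map' ι).constantCoeff_eq_zero
  have hGφ : MvPowerSeries.map φ G = G := mv_map_map_eq_map ι φ hφι F
  have hGeq : compLeft (f.map ι) G = compRight (f.map ι) G :=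
    compLeft_map_eq_compRight_map ι hf.constantCoeff_eq_zero hF0 hF
  rw [compLeft, compRight] at hGeq
  -- `(ψ ∘ G)^φ = ψ^φ ∘ G`
  have hmap : MvPowerSeries.map φ (PowerSeries.subst G ψ) = PowerSeries.subst G (ψ.map φ) := by
    rw [PowerSeries.map_subst hGs, hGφ]
  rw [compLeft, compRight, hmap]
  calc PowerSeries.subst (PowerSeries.subst G ψ) (f'.map ι)
      = PowerSeries.subst G (PowerSeries.subst ψ (f'.map ι)) := by
        rw [PowerSeries.subst_comp_subst_apply hψs hGs]
    _ = PowerSeries.subst G (PowerSeries.subst (f.map ι) (ψ.map φ)) := by rw [hψ]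
    _ = PowerSeries.subst (PowerSeries.subst G (f.map ι)) (ψ.map φ) := by
        rw [PowerSeries.subst_comp_subst_apply hfs hGs]
    _ = PowerSeries.subst (MvPowerSeries.subst
          (fun i : σ => PowerSeries.subst (MvPowerSeries.X i : MvPowerSeries σ A) (f.map ι)) G)
          (ψ.map φ) := by rw [hGeq]
    _ = MvPowerSeries.subst
          (fun i : σ => PowerSeries.subst (MvPowerSeries.X i : MvPowerSeries σ A) (f.map ι))
          (PowerSeries.subst G (ψ.map φ)) := by
        rw [PowerSeries.subst_def, PowerSeries.subst_def, MvPowerSeries.subst_comp_subst_apply hGs.const hd]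

omit [IsAdicComplete (Ideal.span {ι π₀}) A] in
include hφι hf hf' in
/-- **`F' ∘ b` satisfies the twisted relation** if `F' ∈ 𝒪⟦X_σ⟧` (no constant term) commutes with
`f'` and every `b_j ∈ A⟦X_τ⟧` (no constant term) satisfies the twisted relation
`f' ∘ b_j = b_j^φ ∘ (f, …, f)`. [cite: LubinTate1965, Lemma p. 385, (17)] -/
theorem twist_comm_subst {σ τ : Type*} [Fintype σ] [Fintype τ] {F' : MvPowerSeries σ 𝒪}
    (hF0 : F'.constantCoeff = 0) (hF' : compLeft f' F' = compRight f' F')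
    {b : σ → MvPowerSeries τ A} (hb0 : ∀ j, (b j).constantCoeff = 0)
    (hb : ∀ j, PowerSeries.subst (b j) (f'.map ι) =
      MvPowerSeries.subst (fun i : τ => PowerSeries.subst (MvPowerSeries.X i : MvPowerSeries τ A) (f.map ι))
        (MvPowerSeries.map φ (b j))) :
    compLeft (f'.map ι) (MvPowerSeries.subst b (MvPowerSeries.map ι F')) =
      compRight (f.map ι) (MvPowerSeries.map φ (MvPowerSeries.subst b (MvPowerSeries.map ι F'))) := by
  set G : MvPowerSeries σ A := MvPowerSeries.map ι F' with hG
  have hG0 : G.constantCoeff = 0 := by rw [hG, MvPowerSeries.constantCoeff_map, hF0, map_zero]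
  have hGs : PowerSeries.HasSubst G := hasSubst_of_constantCoeff hG0
  have hbs : MvPowerSeries.HasSubst b := MvPowerSeries.hasSubst_of_constantCoeff_zero hb0
  have hbφ0 : ∀ j, (MvPowerSeries.map φ (b j)).constantCoeff = 0 := fun j ↦ by
    rw [MvPowerSeries.constantCoeff_map, hb0, map_zero]
  have hbφs : MvPowerSeries.HasSubst (fun j ↦ MvPowerSeries.map φ (b j)) :=
    MvPowerSeries.hasSubst_of_constantCoeff_zero hbφ0
  have hd' : MvPowerSeries.HasSubst
      (fun i : σ => PowerSeries.subst (MvPowerSeries.X i : MvPowerSeries σ A) (f'.map ι)) :=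
    hasSubst_compRight (hf'.map' ι).constantCoeff_eq_zero
  have hd : MvPowerSeries.HasSubst
      (fun i : τ => PowerSeries.subst (MvPowerSeries.X i : MvPowerSeries τ A) (f.map ι)) :=
    hasSubst_compRight (hf.map' ι).constantCoeff_eq_zero
  have hGφ : MvPowerSeries.map φ G = G := mv_map_map_eq_map ι φ hφι F'
  have hGeq : compLeft (f'.map ι) G = compRight (f'.map ι) G :=
    compLeft_map_eq_compRight_map ι hf'.constantCoeff_eq_zero hF0 hF'
  rw [compLeft, compRight] at hGeq
  rw [compLeft, compRight]
  -- left side: `f' ∘ (G ∘ b) = (f' ∘ G) ∘ b = (G ∘ (f',…)) ∘ b = G ∘ (f' ∘ b_j)_j = G ∘ (b_j^φ ∘ (f,…))_j`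
  have hL : PowerSeries.subst (MvPowerSeries.subst b G) (f'.map ι) =
      MvPowerSeries.subst (fun j ↦ MvPowerSeries.subst
        (fun i : τ => PowerSeries.subst (MvPowerSeries.X i : MvPowerSeries τ A) (f.map ι))
          (MvPowerSeries.map φ (b j))) G := by
    rw [PowerSeries.subst_def, ← MvPowerSeries.subst_comp_subst_apply hGs.const hbs,
      ← PowerSeries.subst_def, hGeq, MvPowerSeries.subst_comp_subst_apply hd' hbs]
    congr 1
    funext j
    rw [PowerSeries.subst_def, MvPowerSeries.subst_comp_subst_apply
      (PowerSeries.HasSubst.of_constantCoeff_zero (MvPowerSeries.constantCoeff_X j)).const hbs,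
      MvPowerSeries.subst_X hbs, ← PowerSeries.subst_def, hb j]
  -- right side: `(G ∘ b)^φ ∘ (f,…) = (G ∘ b^φ) ∘ (f,…) = G ∘ (b_j^φ ∘ (f,…))_j`
  have hR : MvPowerSeries.subst
      (fun i : τ => PowerSeries.subst (MvPowerSeries.X i : MvPowerSeries τ A) (f.map ι))
        (MvPowerSeries.map φ (MvPowerSeries.subst b G)) =
      MvPowerSeries.subst (fun j ↦ MvPowerSeries.subst
        (fun i : τ => PowerSeries.subst (MvPowerSeries.X i : MvPowerSeries τ A) (f.map ι))
          (MvPowerSeries.map φ (b j))) G := by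
    rw [MvPowerSeries.map_subst hbs, hGφ, MvPowerSeries.subst_comp_subst_apply hbφs hd]
  rw [hL, hR]

/-! ### `ϑ ∘ F_f = F_{f'} ∘ (ϑ × ϑ)` -/

variable (h𝒪 : IsLTRing π₀ q) (h𝒪' : IsLTRing ((u₀ : 𝒪) * π₀) q) {ε : A} (hε : φ ε = ι u₀ * ε)

include hφι h𝒪 h𝒪' in
/-- **Lubin–Tate (17): `ϑ(F_f(X₀, X₁)) = F_{f'}(ϑ(X₀), ϑ(X₁))`** — the comparison series is an
isomorphism of formal groups `F_f ≃ F_{f'}` (over `A = 𝒪̂_{K^nr}`; de Shalit's `θ : Ĝ_m ≃ F_f` for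
`f = (1+X)^p − 1`). Both sides are `≡ ε(X₀ + X₁) (mod deg 2)` and satisfy `f' ∘ Φ = Φ^φ ∘ (f, f)`.
[cite: LubinTate1965, Lemma p. 385, (17)] [cite: CasselsFrohlichANT1967, Ch. VI §3.7 Lemma 1] -/
theorem subst_ltF_compSeries :
    PowerSeries.subst (MvPowerSeries.map ι (ltF h𝒪 hf)) (compSeries ι φ hA hf hf' hε) =
      MvPowerSeries.subst
        ![PowerSeries.subst (MvPowerSeries.X 0 : MvPowerSeries (Fin 2) A) (compSeries ι φ hA hf hf' hε),
          PowerSeries.subst (MvPowerSeries.X 1 : MvPowerSeries (Fin 2) A) (compSeries ι φ hA hf hf' hε)]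
        (MvPowerSeries.map ι (ltF h𝒪' hf')) := by
  set ϑ := compSeries ι φ hA hf hf' hε with hϑ
  have hϑ0 : PowerSeries.constantCoeff ϑ = 0 := constantCoeff_compSeries ι φ hA hf hf' hε
  have hϑtw := subst_compSeries ι φ hA hf hf' hε
  set G : MvPowerSeries (Fin 2) A := MvPowerSeries.map ι (ltF h𝒪 hf) with hG
  set G' : MvPowerSeries (Fin 2) A := MvPowerSeries.map ι (ltF h𝒪' hf') with hG'
  have hG0 : G.constantCoeff = 0 := by
    rw [hG, MvPowerSeries.constantCoeff_map, constantCoeff_ltF, map_zero]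
  have hG'0 : G'.constantCoeff = 0 := by
    rw [hG', MvPowerSeries.constantCoeff_map, constantCoeff_ltF, map_zero]
  set c : Fin 2 → MvPowerSeries (Fin 2) A :=
    ![PowerSeries.subst (MvPowerSeries.X 0 : MvPowerSeries (Fin 2) A) ϑ,
      PowerSeries.subst (MvPowerSeries.X 1 : MvPowerSeries (Fin 2) A) ϑ] with hc
  have hcj : ∀ j : Fin 2, c j = PowerSeries.subst (MvPowerSeries.X j : MvPowerSeries (Fin 2) A) ϑ := by
    intro j; fin_cases j <;> rfl
  have hc0 : ∀ j : Fin 2, (c j).constantCoeff = 0 := fun j ↦ by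
    rw [hcj, PowerSeries.subst_def]
    exact MvPowerSeries.constantCoeff_subst_eq_zero
      (MvPowerSeries.hasSubst_of_constantCoeff_zero fun _ => MvPowerSeries.constantCoeff_X j)
      (fun _ => MvPowerSeries.constantCoeff_X j) hϑ0
  refine eq_of_twistDefect_eq_zero (σ := Fin 2) φ hA (isLTSeries_map_f' ι hf') (hf.map' ι) ?_ ?_ ?_ ?_ ?_
  · -- no constant term: `ϑ ∘ G`
    rw [PowerSeries.subst_def]
    exact MvPowerSeries.constantCoeff_subst_eq_zero
      (MvPowerSeries.hasSubst_of_constantCoeff_zero fun _ => hG0) (fun _ => hG0) hϑ0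
  · -- no constant term: `G' ∘ c`
    exact MvPowerSeries.constantCoeff_subst_eq_zero
      (MvPowerSeries.hasSubst_of_constantCoeff_zero hc0) hc0 hG'0
  · -- linear parts: both `ε X_i`
    intro i
    have h1 : MvPowerSeries.coeff (Finsupp.single i 1) (PowerSeries.subst G ϑ) = PowerSeries.coeff 1 ϑ * ι 1 := by
      rw [PowerSeries.subst_def, coeff_single_subst (fun _ => hG0), Fintype.sum_unique, hG,
        MvPowerSeries.coeff_map, coeff_ltF_single]
      rfl
    have h2 : MvPowerSeries.coeff (Finsupp.single i 1) (MvPowerSeries.subst c G') =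
        ∑ j : Fin 2, ι 1 * MvPowerSeries.coeff (Finsupp.single i 1) (c j) := by
      rw [coeff_single_subst hc0]
      refine Finset.sum_congr rfl fun j _ ↦ ?_
      rw [hG', MvPowerSeries.coeff_map, coeff_ltF_single]
    have h3 : ∀ j : Fin 2, MvPowerSeries.coeff (Finsupp.single i 1) (c j) =
        PowerSeries.coeff 1 ϑ * (if i = j then 1 else 0) := fun j ↦ by
      classical
      rw [hcj, PowerSeries.subst_def, coeff_single_subst (fun _ => MvPowerSeries.constantCoeff_X j),
        Fintype.sum_unique, MvPowerSeries.coeff_index_single_X]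
      rfl
    rw [h1, h2]
    simp_rw [h3]
    rw [Fin.sum_univ_two, map_one]
    fin_cases i <;> simp
  · -- twisted relation for `ϑ ∘ G`
    rw [twistDefect, sub_eq_zero]
    exact twist_subst_of_comm ι φ hφι hf hϑ0 hϑtw (constantCoeff_ltF h𝒪 hf) (compLeft_ltF h𝒪 hf)
  · -- twisted relation for `G' ∘ c`
    rw [twistDefect, sub_eq_zero]
    refine twist_comm_subst ι φ hφι hf hf' (constantCoeff_ltF h𝒪' hf') (compLeft_ltF h𝒪' hf') hc0
      fun j ↦ ?_
    -- each `ϑ(X_j)` satisfies the twisted relation: `f' ∘ ϑ(X_j) = (ϑ^φ ∘ f)(X_j) = ϑ^φ(X_j) ∘ (f, f)`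
    have hϑs : PowerSeries.HasSubst ϑ := PowerSeries.HasSubst.of_constantCoeff_zero' hϑ0
    have hXs : PowerSeries.HasSubst (MvPowerSeries.X j : MvPowerSeries (Fin 2) A) :=
      PowerSeries.HasSubst.of_constantCoeff_zero (MvPowerSeries.constantCoeff_X j)
    have hfs : PowerSeries.HasSubst (f.map ι) :=
      PowerSeries.HasSubst.of_constantCoeff_zero' (hf.map' ι).constantCoeff_eq_zero
    have hd : MvPowerSeries.HasSubst
        (fun i : Fin 2 => PowerSeries.subst (MvPowerSeries.X i : MvPowerSeries (Fin 2) A) (f.map ι)) :=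
      hasSubst_compRight (hf.map' ι).constantCoeff_eq_zero
    rw [hcj]
    calc PowerSeries.subst (PowerSeries.subst (MvPowerSeries.X j : MvPowerSeries (Fin 2) A) ϑ) (f'.map ι)
        = PowerSeries.subst (MvPowerSeries.X j : MvPowerSeries (Fin 2) A) (PowerSeries.subst ϑ (f'.map ι)) := by
          rw [PowerSeries.subst_comp_subst_apply hϑs hXs]
      _ = PowerSeries.subst (MvPowerSeries.X j : MvPowerSeries (Fin 2) A)
            (PowerSeries.subst (f.map ι) (ϑ.map φ)) := by rw [hϑtw]
      _ = PowerSeries.subst (PowerSeries.subst (MvPowerSeries.X j : MvPowerSeries (Fin 2) A) (f.map ι))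
            (ϑ.map φ) := by rw [PowerSeries.subst_comp_subst_apply hfs hXs]
      _ = MvPowerSeries.subst
            (fun i : Fin 2 => PowerSeries.subst (MvPowerSeries.X i : MvPowerSeries (Fin 2) A) (f.map ι))
            (MvPowerSeries.map φ (PowerSeries.subst (MvPowerSeries.X j : MvPowerSeries (Fin 2) A) ϑ)) := by
          rw [PowerSeries.map_subst hXs, MvPowerSeries.map_X]
          conv_rhs => rw [PowerSeries.subst_def, MvPowerSeries.subst_comp_subst_apply hXs.const hd]
          rw [PowerSeries.subst_def]
          congr 1
          funext s
          rw [MvPowerSeries.subst_X hd]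

end GroupLaw

end LubinTate

end Literature.NumberTheory.GaloisRepresentations

end
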